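import Summits.CriticalPhenomena.PercolationContinuityZ3.Theses.PercLowPointHalfSpace
import Literature.Probability.Percolation.BondTwoArmsAKN

/-!
# Sketch — first lemmas for two crux ideas on `QuantitativeBGN` (stmt-CriticalPhenomena-0913)

Planner sketch (crux-ideate round 1, ideator 2). Nothing here is proved; the point is that the
signatures of the first checkable statements of each line elaborate over existing declarations.

* Idea A `microscopic-floor-doubling-gain`: the depth-indexed boundary arm
  `γ_r(h) = P_{p_c}(C_H(h e₀) reaches sup-distance r from h e₀)`, its free monotonicity in `h`
  (vertical shift + domain inclusion), the uniform doubling gain `(G)`, and the iteration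
  `(G) → QuantitativeBGN`.
* Idea B `mirror-akn-two-arm-import`: the reflection coupling across the layer between levels
  `0` and `1`: two independent, automatically half-space-disjoint boundary arms at the two
  endpoints of the vertical edge `{0, e₀}`; on the event that their bulk clusters (inside the box)
  are distinct this is the AKN two-arms event `AKN.edgeTwoArms 0 m`, whose probability is
  `≤ κ (1 + log m)/√m` at `p_c` (PROVED in tree: `AKN.exists_real_edgeTwoArms_le`). Hence
  `θ_H(m)² · P(distinct | both arms) ≤ κ(1+log m)/√m`, and `MirrorDistinctness (λ < 1/2)` gives
  `QuantitativeBGN` with `a = (1/2 - λ)/2 - ε`.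
-/

noncomputable section

namespace Summit.CriticalPhenomena.PercolationContinuityZ3.Cruxes.QuantitativeBGN.Sketch

open MeasureTheory Literature.Probability.Percolation Literature.Probability.LatticeModels
open Summit.CriticalPhenomena.PercolationContinuityZ3.Theses.PercLowPointHalfSpace

/-- The critical bond percolation measure on `ℤ³`. -/
abbrev μc : Measure (BondConfig (Site 3)) := bondPercolation (zdGraph 3) (criticalProbI 3)

/-- The half-space `H = {x₀ ≥ 0}`. -/
abbrev Hsp : Set (Site 3) := {x | 0 ≤ x 0}

/-! ## Idea A: depth-indexed boundary arm and the uniform doubling gain -/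

/-- `armFrom r h`: the `H`-cluster of the point `h e₀` (height `h` above the floor) reaches
sup-distance `≥ r` from its starting point. For `h = 0` this is the event of the crux. -/
def armFrom (r h : ℕ) : Set (BondConfig (Site 3)) :=
  {ω | ∃ y : Site 3, (∃ i : Fin 3, (r : ℤ) ≤ |y i - (Pi.single 0 (h : ℤ) : Site 3) i|) ∧
    ω ∈ openConnIn Hsp (Pi.single 0 (h : ℤ)) y}

/-- `γ_r(h) := P_{p_c}(armFrom r h)`. -/
def gammaR (r h : ℕ) : ℝ := μc.real (armFrom r h)

/-- Sanity: at depth `0` the event is literally the crux event (after `Pi.single 0 0 = 0`). -/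
theorem armFrom_zero (r : ℕ) :
    armFrom r 0 = {ω | ∃ y : Site 3, (∃ i : Fin 3, (r : ℤ) ≤ |y i|) ∧ ω ∈ openConnIn Hsp 0 y} := by
  ext ω
  simp [armFrom]

/-- FREE MONOTONICITY (vertical shift by one + `H₁ ⊆ H`): `γ_r(h) ≤ γ_r(h+1)`.
First lemma of idea A, provable now (translation invariance of `bondPercolation` under the shift
`x ↦ x + e₀`, `Literature/Probability/Percolation/BondPercolationSymmetry.lean`, and
`openConnIn_mono`). -/
theorem gammaR_mono (r h : ℕ) : gammaR r h ≤ gammaR r (h + 1) := by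
  sorry

/-- The reverse comparison for free as well (append the vertical edge below the start, Harris):
`p_c · γ_{r+1}(h+1) ≤ γ_r(h)`; so consecutive depths are comparable within the factor `1/p_c ≈ 4`
and all content of `(G)` is in the ACCUMULATED gain over a dyadic block of depths. -/
theorem gammaR_succ_le (r h : ℕ) :
    (criticalProbI 3 : ℝ) * gammaR (r + 1) (h + 1) ≤ gammaR r h := by
  sorry

/-- **(G) uniform microscopic floor-doubling gain**: doubling the depth of the starting point
below which the floor lies multiplies the arm probability by at least `1 + κ`, uniformly for
depths up to `r^δ`. (Predicted gain `2^{x_s - x_b} ≈ 2^{0.50}` in `d = 3`, `2^{11/48}` in `d = 2`,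
`2^{1}` in `d ≥ 7`.) -/
def FloorDoublingGain : Prop :=
  ∃ κ δ : ℝ, 0 < κ ∧ 0 < δ ∧ ∀ r h : ℕ, 1 ≤ h → ((2 * h : ℕ) : ℝ) ≤ (r : ℝ) ^ δ →
    (1 + κ) * gammaR r h ≤ gammaR r (2 * h)

/-- ITERATION LEMMA (pure real analysis + `γ ≤ 1` + `gammaR_mono`): `(G) → QuantitativeBGN`
with `a = δ · log₂(1+κ)` (up to the rounding of `r^δ` to a power of two). This is the composition
step of the line; no percolation input beyond monotonicity. -/
theorem quantitativeBGN_of_floorDoublingGain (hG : FloorDoublingGain) : QuantitativeBGN := by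
  sorry

/-- Equivalent bookkeeping through the NEEDED DIP: for the bulk configuration let
`D_r := min { h : armFrom r h holds after shifting the start to 0 }`; then `P(D_r ≤ h) = γ_r(h)`
and `(G)` reads `P(D_r ≤ 2h) ≥ (1+κ) P(D_r ≤ h)` — the law of the minimal dip of a critical arm
below its starting level is doubling-regular near `0`. Recorded as the increment form. -/
def DipIncrementRegular : Prop :=
  ∃ κ δ : ℝ, 0 < κ ∧ 0 < δ ∧ ∀ r h : ℕ, 1 ≤ h → ((2 * h : ℕ) : ℝ) ≤ (r : ℝ) ^ δ →
    κ * gammaR r h ≤ gammaR r (2 * h) - gammaR r h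

theorem floorDoublingGain_iff_dip : FloorDoublingGain ↔ DipIncrementRegular := by
  constructor
  · rintro ⟨κ, δ, hκ, hδ, h⟩
    exact ⟨κ, δ, hκ, hδ, fun r hh h1 h2 => by have := h r hh h1 h2; linarith⟩
  · rintro ⟨κ, δ, hκ, hδ, h⟩
    exact ⟨κ, δ, hκ, hδ, fun r hh h1 h2 => by have := h r hh h1 h2; linarith⟩

/-! ## Idea B: the mirror coupling and the AKN two-arms import -/

/-- Arm of the UPPER half-space `{x₀ ≥ 1}` from its floor point `e₀`, to sup-distance `m`. -/
def armUp (m : ℕ) : Set (BondConfig (Site 3)) :=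
  {ω | ∃ y : Site 3, (∃ i : Fin 3, (m : ℤ) ≤ |y i - (Pi.single 0 1 : Site 3) i|) ∧
    ω ∈ openConnIn {x : Site 3 | 1 ≤ x 0} (Pi.single 0 1) y}

/-- Arm of the LOWER half-space `{x₀ ≤ 0}` from its ceiling point `0`, to sup-distance `m`
(the mirror image of `armUp m` under `x₀ ↦ 1 - x₀`, and of the crux event under `x₀ ↦ -x₀`). -/
def armDn (m : ℕ) : Set (BondConfig (Site 3)) :=
  {ω | ∃ y : Site 3, (∃ i : Fin 3, (m : ℤ) ≤ |y i|) ∧ ω ∈ openConnIn {x : Site 3 | x 0 ≤ 0} 0 y}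

/-- Bulk distinctness inside the box `Λ_m`: `e₀` is not in the cluster of `0` for the
configuration restricted to the steps inside `Λ_m` (the distinctness clause of
`AKN.edgeTwoArms 0 m`). A DECREASING event of the layer edges given the two half-configurations. -/
def mirrorDistinct (m : ℕ) : Set (BondConfig (Site 3)) :=
  {ω | (Pi.single 0 1 : Site 3) ∉ openClusterIn (withinGraph (zdGraph 3) ↑(box 3 m)) ω 0}

/-- CONTAINMENT (first-exit lemma `AKN.reaches_of_reachable` for each arm): two mirror arms with
distinct bulk clusters realise the AKN two-arms event of the vertical edge `{0, e₀}`. -/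
theorem mirror_subset_edgeTwoArms (m : ℕ) (hm : 1 ≤ m) :
    armUp m ∩ armDn m ∩ mirrorDistinct m ⊆ AKN.edgeTwoArms (d := 3) 0 m := by
  sorry

/-- INDEPENDENCE: `armUp m` is determined by the edges inside `{x₀ ≥ 1}`, `armDn m` by those
inside `{x₀ ≤ 0}`; these edge sets are disjoint (the layer edges belong to neither), so the two
arms are independent under the product measure (`real_inter_of_determinedBy_disjoint` in tree). -/
theorem mirror_indep (m : ℕ) :
    μc.real (armUp m ∩ armDn m) = μc.real (armUp m) * μc.real (armDn m) := by
  sorry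

/-- SYMMETRY: both mirror arms have the probability of the crux event at scale `m`
(lattice reflections `x₀ ↦ 1 - x₀`, `x₀ ↦ -x₀`; `BondPercolationSymmetry.lean`). -/
theorem mirror_symm (m : ℕ) :
    μc.real (armUp m) = μc.real (armDn m) ∧
    μc.real (armDn m) = μc.real {ω | ∃ y : Site 3, (∃ i : Fin 3, (m : ℤ) ≤ |y i|) ∧
      ω ∈ openConnIn Hsp 0 y} := by
  sorry

/-- THE MIRROR–AKN INEQUALITY (from the three lemmas above and `AKN.exists_real_edgeTwoArms_le`
at `p = p_c ∈ [δ, 1-δ]`, `criticalProb_zd_pos/lt_one`): there is `κ` with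
`θ_H(m) · P(armUp ∩ armDn ∩ distinct)/P(armUp ∩ armDn)·θ_H(m) ≤ κ (1 + log m)/√m`, written
without division. -/
theorem mirror_akn :
    ∃ κ : ℝ, 0 < κ ∧ ∀ m : ℕ, 1 ≤ m →
      μc.real (armUp m ∩ armDn m ∩ mirrorDistinct m) ≤ κ * (1 + Real.log m) / Real.sqrt m := by
  sorry

/-- **MirrorDistinctness(λ)**, the crux of idea B: conditionally on both mirror arms, the two
bulk clusters are distinct inside `Λ_m` with probability at least `c m^{-λ}` for some `λ < 1/2`.
(Heuristic value in `d = 3`: `λ` = non-coincidence exponent of two independent boundary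
footprints of dimension `2 - x_s ≈ 1.025` in the plane plus indirect gluing cascades, expected
small; in `d = 2` the analogue is FALSE by exact exponents, `2/3 + λ ≥ 5/4`.) -/
def MirrorDistinctness : Prop :=
  ∃ lam c : ℝ, lam < 1 / 2 ∧ 0 < c ∧ ∀ m : ℕ, 1 ≤ m →
    c * (m : ℝ) ^ (-lam) * μc.real (armUp m ∩ armDn m) ≤ μc.real (armUp m ∩ armDn m ∩ mirrorDistinct m)

/-- COMPOSITION: `MirrorDistinctness → QuantitativeBGN` (with any `a < (1/2 - λ)/2`): combine
`mirror_akn`, `mirror_indep`, `mirror_symm` and absorb `(1 + log m)` into `m^{ε}`. -/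
theorem quantitativeBGN_of_mirrorDistinctness (h : MirrorDistinctness) : QuantitativeBGN := by
  sorry

/-- Harris lower bound reducing distinctness to the footprint (the crude route, recorded to be
REJECTED by the card: its exponent is the floor-avoidance exponent, `5/3` in `d = 2`):
closing every layer edge above the level-`0` footprint of the lower cluster isolates it. -/
def TiltedFootprintLowerBound : Prop :=
  ∃ lam c : ℝ, lam < 1 / 2 ∧ 0 < c ∧ ∀ m : ℕ, 1 ≤ m →
    c * (m : ℝ) ^ (-lam) * μc.real (armDn m) ≤
      (∫⁻ ω, (armDn m).indicator (fun ω => ENNReal.ofReal ((1 - (criticalProbI 3 : ℝ)) ^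
        (Set.ncard {y : Site 3 | y 0 = 0 ∧ (∀ i, |y i| ≤ m) ∧ ω ∈ openConnIn {x : Site 3 | x 0 ≤ 0} 0 y}))) ω ∂μc).toReal

theorem mirrorDistinctness_of_tiltedFootprint (h : TiltedFootprintLowerBound) : MirrorDistinctness := by
  sorry

end Summit.CriticalPhenomena.PercolationContinuityZ3.Cruxes.QuantitativeBGN.Sketch

end
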